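import Summits.AtomisticToContinuum.HydrodynamicLimit.Theses.OneFlightGossipEngine

/-!
# Sketch — crux-ideate round 1, ideator 1, crux `LocalClampedTransferLDAlongFamilies`
# (stmt-AtomisticToContinuum-17691, route OneFlightGossipEngine)

Typed first lemmas and transfer statements of the two idea cards

* `clamp-statics-net` (card 1): `ClampedRowTestAdditive` (PROVED below), `ClampedMomentumRowTestModulus`,
  `ClampedEnergyRowTestModulus` (pathwise, provable now), and the transfer target
  `LocalClampedTransferLDSharp` (= the crux profile-wise with NUMERIC thresholds `V₀, β₀` depending on the
  data only through bounds).
* `deficit-localises-first-moment` (card 2): `transferAct`, `HomDeficitDecayUniform`, `LocalDeficitDecay`,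
  `DeficitLocalisation`.

Nothing here is an item; nothing is proposed to the tree.
-/

noncomputable section

namespace Summit.AtomisticToContinuum.HydrodynamicLimit.Cruxes.LocalClampedTransferLDAlongFamilies.IdeatorOne

open MeasureTheory Set Filter Topology Finset
open scoped ENNReal BigOperators
open Literature.MathematicalPhysics.KineticTheory Literature.Analysis.FluidPDE Literature.Analysis.FunctionSpaces

/-! ### Card 1 — the clamped rows are linear and pathwise Lipschitz in the test function -/

/-- The clamped momentum row of the crux as a function of the test function `ψ` (general curve `γ`,
window `S`, weights `ω`). [folklore] -/
def momRow {N : ℕ} (ε : ℝ) (γ : ℝ → Config N (Fin 3) T3) (S : Set ℝ) (ω : Fin N → ℝ)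
    (ψ : T3 → ℝ) (k : Fin 3) : ℝ :=
  collisionSum (Torus.geometry (Fin 3)) ε γ S
    (fun c => ω c.fst * ω c.snd * ((ψ c.fstPos - ψ c.sndPos) * (c.postVel.1 k - c.preVel.1 k)) / 2)

/-- The clamped energy row of the crux as a function of the test function `ψ`. [folklore] -/
def enRow {N : ℕ} (ε : ℝ) (γ : ℝ → Config N (Fin 3) T3) (S : Set ℝ) (ω : Fin N → ℝ)
    (ψ : T3 → ℝ) : ℝ :=
  collisionSum (Torus.geometry (Fin 3)) ε γ S
    (fun c => ω c.fst * ω c.snd * ((ψ c.fstPos - ψ c.sndPos) * ((‖c.postVel.1‖ ^ 2 - ‖c.preVel.1‖ ^ 2) / 2)) / 2)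

/-- **ADDITIVITY IN THE TEST FUNCTION** (the clamp does not see `ψ`): on an orbit with finitely many
collision times in the window both clamped rows are additive in `ψ`; hence `X[φ_s] − X[φ_{s'}] = X[φ_s − φ_{s'}]`
and the family axis of the test function reduces to ONE row with a small test function. [folklore] -/
def ClampedRowTestAdditive : Prop :=
  ∀ (ε : ℝ) (N : ℕ) (γ : ℝ → Config N (Fin 3) T3) (S : Set ℝ),
    (collisionTimes (Torus.geometry (Fin 3)) ε γ ∩ S).Finite →
    ∀ (ω : Fin N → ℝ) (ψ ψ' : T3 → ℝ),
      (∀ k : Fin 3, momRow ε γ S ω (ψ + ψ') k = momRow ε γ S ω ψ k + momRow ε γ S ω ψ' k) ∧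
        enRow ε γ S ω (ψ + ψ') = enRow ε γ S ω ψ + enRow ε γ S ω ψ'

theorem clampedRowTestAdditive_holds : ClampedRowTestAdditive := by
  intro ε N γ S hfin ω ψ ψ'
  refine ⟨fun k => ?_, ?_⟩
  · simp only [momRow, collisionSum_eq_finset_sum hfin, ← Finset.sum_add_distrib]
    refine Finset.sum_congr rfl fun t _ => Finset.sum_congr rfl fun p _ => ?_
    simp only [Pi.add_apply]
    ring
  · simp only [enRow, collisionSum_eq_finset_sum hfin, ← Finset.sum_add_distrib]
    refine Finset.sum_congr rfl fun t _ => Finset.sum_congr rfl fun p _ => ?_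
    simp only [Pi.add_apply]
    ring

/-- **PATHWISE TEST-FUNCTION MODULUS OF THE CLAMPED MOMENTUM ROWS** (the `ω_fst ω_snd ≤ ω_fst` twin of the
landed `ClampedCurrentsDockClampRemainder.abs_collisionSum_unclamped_le_transfer`): if the test function
oscillates by at most `L` across every contact in the window (`L = ‖∇ψ‖_∞ ε_N` for a `C¹` test function),
then `|X^m_k[ψ]| ≤ (L/2) Σ_i ω_i · (momentum activity of i)`; with `ω_i = 1{act_i ≤ V}` and
`ε_N τ/σ = w` this is `|w⁻¹ X^m_k[ψ]| ≤ ½ ‖∇ψ‖_∞ V (N+1)` — the clamp makes the row a Lipschitz function of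
the test function, PATHWISE, with no moment input. Provable now (finite double sum, `|ω_snd| ≤ 1`,
swap symmetry of `‖Δv‖`). [folklore] -/
def ClampedMomentumRowTestModulus : Prop :=
  ∀ (ε : ℝ) (N : ℕ) (γ : ℝ → Config N (Fin 3) T3) (S : Set ℝ),
    (Torus.geometry (Fin 3)).IsHardSphereRegular ε →
    (collisionTimes (Torus.geometry (Fin 3)) ε γ ∩ S).Finite →
    ∀ (ω : Fin N → ℝ), (∀ i, 0 ≤ ω i) → (∀ i, ω i ≤ 1) →
    ∀ (ψ : T3 → ℝ) (L : ℝ), 0 ≤ L →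
      (∀ t ∈ collisionTimes (Torus.geometry (Fin 3)) ε γ ∩ S,
        ∀ p ∈ contactPairs (Torus.geometry (Fin 3)) ε (γ t), |ψ (γ t p.1).1 - ψ (γ t p.2).1| ≤ L) →
    ∀ k : Fin 3,
      |momRow ε γ S ω ψ k| ≤
        L / 2 * ∑ i, ω i * collisionSum (Torus.geometry (Fin 3)) ε γ S
          (fun c => if c.fst = i then ‖c.postVel.1 - c.preVel.1‖ else 0)

/-- **PATHWISE TEST-FUNCTION MODULUS OF THE CLAMPED ENERGY ROW** (same, with the energy impulse
`|‖v⁺‖² − ‖v⁻‖²|/2`, swap-symmetric by pair energy conservation). [folklore] -/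
def ClampedEnergyRowTestModulus : Prop :=
  ∀ (ε : ℝ) (N : ℕ) (γ : ℝ → Config N (Fin 3) T3) (S : Set ℝ),
    (Torus.geometry (Fin 3)).IsHardSphereRegular ε →
    (collisionTimes (Torus.geometry (Fin 3)) ε γ ∩ S).Finite →
    ∀ (ω : Fin N → ℝ), (∀ i, 0 ≤ ω i) → (∀ i, ω i ≤ 1) →
    ∀ (ψ : T3 → ℝ) (L : ℝ), 0 ≤ L →
      (∀ t ∈ collisionTimes (Torus.geometry (Fin 3)) ε γ ∩ S,
        ∀ p ∈ contactPairs (Torus.geometry (Fin 3)) ε (γ t), |ψ (γ t p.1).1 - ψ (γ t p.2).1| ≤ L) →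
      |enRow ε γ S ω ψ| ≤
        L / 2 * ∑ i, ω i * collisionSum (Torus.geometry (Fin 3)) ε γ S
          (fun c => if c.fst = i then |‖c.postVel.1‖ ^ 2 - ‖c.preVel.1‖ ^ 2| / 2 else 0)

/-- Regrouping a first-partner-weighted record sum by particles (the proof of the landed
`ClampedCurrentsDockClampRemainder.collisionSum_fst_mul_eq_sum_transfer`, for a general impulse `ι`).
[folklore] -/
theorem collisionSum_fst_mul_eq_sum {N : ℕ} {ε : ℝ} {γ : ℝ → Config N (Fin 3) T3} {S : Set ℝ}
    (hfin : (collisionTimes (Torus.geometry (Fin 3)) ε γ ∩ S).Finite) (f : Fin N → ℝ)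
    (ι : HardSphereCollisionRecord (Fin 3) T3 N → ℝ) :
    collisionSum (Torus.geometry (Fin 3)) ε γ S (fun c => f c.fst * ι c) =
      ∑ i, f i * collisionSum (Torus.geometry (Fin 3)) ε γ S (fun c => if c.fst = i then ι c else 0) := by
  simp only [collisionSum_eq_finset_sum hfin, Finset.mul_sum]
  rw [Finset.sum_comm]
  refine Finset.sum_congr rfl fun t _ => ?_
  rw [Finset.sum_comm]
  refine Finset.sum_congr rfl fun p _ => ?_
  simp only [HardSphereCollisionRecord.ofConfig_fst, mul_ite, mul_zero]
  rw [Finset.sum_ite_eq Finset.univ p.1]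
  simp

/-- **The clamped-row bound, generic in the mark** (`|m c| ≤ ι c` for every record): the `ω_fst ω_snd ≤ ω_fst`
twin of the landed clamp-remainder lemma. [folklore] -/
theorem abs_clampedRow_le {N : ℕ} {ε : ℝ} {γ : ℝ → Config N (Fin 3) T3} {S : Set ℝ}
    (hfin : (collisionTimes (Torus.geometry (Fin 3)) ε γ ∩ S).Finite) {ω : Fin N → ℝ}
    (hω0 : ∀ i, 0 ≤ ω i) (hω1 : ∀ i, ω i ≤ 1) {ψ : T3 → ℝ} {L : ℝ} (hL : 0 ≤ L)
    (hψ : ∀ t ∈ collisionTimes (Torus.geometry (Fin 3)) ε γ ∩ S,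
      ∀ p ∈ contactPairs (Torus.geometry (Fin 3)) ε (γ t), |ψ (γ t p.1).1 - ψ (γ t p.2).1| ≤ L)
    (m ι : HardSphereCollisionRecord (Fin 3) T3 N → ℝ) (hm : ∀ c, |m c| ≤ ι c) :
    |collisionSum (Torus.geometry (Fin 3)) ε γ S
        (fun c => ω c.fst * ω c.snd * ((ψ c.fstPos - ψ c.sndPos) * m c) / 2)| ≤
      L / 2 * ∑ i, ω i * collisionSum (Torus.geometry (Fin 3)) ε γ S (fun c => if c.fst = i then ι c else 0) := by
  have key : |collisionSum (Torus.geometry (Fin 3)) ε γ S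
      (fun c => ω c.fst * ω c.snd * ((ψ c.fstPos - ψ c.sndPos) * m c) / 2)| ≤
      collisionSum (Torus.geometry (Fin 3)) ε γ S (fun c => (ω c.fst * (L / 2)) * ι c) := by
    simp only [collisionSum_eq_finset_sum hfin]
    refine (Finset.abs_sum_le_sum_abs _ _).trans (Finset.sum_le_sum fun t ht => ?_)
    refine (Finset.abs_sum_le_sum_abs _ _).trans (Finset.sum_le_sum fun p hp => ?_)
    have ht' : t ∈ collisionTimes (Torus.geometry (Fin 3)) ε γ ∩ S := (Set.Finite.mem_toFinset hfin).1 ht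
    have hψp := hψ t ht' p hp
    set c := HardSphereCollisionRecord.ofConfig (Torus.geometry (Fin 3)) ε (γ t) t p.1 p.2 with hc
    have hfst : c.fst = p.1 := rfl
    have hsnd : c.snd = p.2 := rfl
    have hfp : c.fstPos = (γ t p.1).1 := rfl
    have hsp : c.sndPos = (γ t p.2).1 := rfl
    rw [hfst, hsnd, hfp, hsp]
    have h1 : 0 ≤ ω p.1 := hω0 p.1
    have h2 : 0 ≤ ω p.2 := hω0 p.2
    have h2' : ω p.2 ≤ 1 := hω1 p.2
    have hmc := hm c
    have hι : 0 ≤ ι c := (abs_nonneg _).trans hmc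
    rw [abs_div, abs_mul, abs_mul, abs_mul, abs_of_nonneg h1, abs_of_nonneg h2, abs_two]
    calc ω p.1 * ω p.2 * (|ψ (γ t p.1).1 - ψ (γ t p.2).1| * |m c|) / 2
        ≤ ω p.1 * 1 * (L * ι c) / 2 := by gcongr
      _ = ω p.1 * (L / 2) * ι c := by ring
  rw [collisionSum_fst_mul_eq_sum hfin (fun i => ω i * (L / 2)) ι] at key
  refine key.trans (le_of_eq ?_)
  rw [Finset.mul_sum]
  exact Finset.sum_congr rfl fun i _ => by ring

theorem clampedMomentumRowTestModulus_holds : ClampedMomentumRowTestModulus := by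
  intro ε N γ S _hG hfin ω hω0 hω1 ψ L hL hψ k
  refine abs_clampedRow_le hfin hω0 hω1 hL hψ (fun c => c.postVel.1 k - c.preVel.1 k)
    (fun c => ‖c.postVel.1 - c.preVel.1‖) fun c => ?_
  simpa [Real.norm_eq_abs] using PiLp.norm_apply_le (c.postVel.1 - c.preVel.1) k

theorem clampedEnergyRowTestModulus_holds : ClampedEnergyRowTestModulus := by
  intro ε N γ S _hG hfin ω hω0 hω1 ψ L hL hψ
  refine abs_clampedRow_le hfin hω0 hω1 hL hψ (fun c => (‖c.postVel.1‖ ^ 2 - ‖c.preVel.1‖ ^ 2) / 2)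
    (fun c => |‖c.postVel.1‖ ^ 2 - ‖c.preVel.1‖ ^ 2| / 2) fun c => ?_
  rw [abs_div, abs_two]

/-! ### Card 1 — the transfer target `LCT♯`: the crux PROFILE-WISE with NUMERIC thresholds

`LocalClampedTransferLDSharp` is the crux with the one-parameter family replaced by ONE profile triple and
ONE test function, and with the thresholds `V₀, β₀` moved IN FRONT of the profiles / flows / test
function: they depend on the data only through the bounds `Θ` (temperature), `U` (drift), `Am ≤ a ≤ AM`
(activity), `Lφ` (C²-size of the test function), `σ` and `η₀`. Card 1: `LCT♯ ⟹ crux` by a finite net in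
`s` (static Rényi-2 law swap + the pathwise moduli above + energy conservation); every engine producing the
crux produces `LCT♯`. -/

/-- `LCT♯` — the profile-wise collisional node with numeric thresholds (the crux's `let` block verbatim,
`a s ↦ a`, `θ₀ s ↦ θ₀`, `u₀ s ↦ u₀`, `φ s ↦ φ`). [folklore] -/
def LocalClampedTransferLDSharp : Prop :=
  ∃ η₀ : ℝ, 0 < η₀ ∧ ∀ (Θ U Am AM Lφ : ℝ), 0 < Am → ∀ σ : ℝ, 0 < σ → σ < 1 / 2 →
    ∃ V₀ : ℝ, 0 < V₀ ∧ ∀ V : ℝ, V₀ ≤ V → ∃ β₀ : ℝ, 0 < β₀ ∧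
    ∀ (a θ₀ : T3 → ℝ) (u₀ : T3 → V3) (ha : Continuous a), Continuous θ₀ → Continuous u₀ →
    ∀ (ha0 : ∀ x, 0 < a x), (∀ x, 0 < θ₀ x) →
    (∀ x, θ₀ x ≤ Θ) → (∀ x, ‖u₀ x‖ ≤ U) → (∀ x, Am ≤ a x) → (∀ x, a x ≤ AM) →
    σ ^ 3 * (⨆ x, a x) ≤ η₀ * ∫ x, a x →
    ∀ Φ : (N : ℕ) → HardSphereFlow (Torus.geometry (Fin 3)) (hsDiameter σ N) (N + 1),
    ∀ φ : T3 → ℝ, Torus.IsSmooth φ →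
      (∀ (k : Fin 3) x, |Torus.partialDeriv k φ x| ≤ Lφ) →
      (∀ (k l : Fin 3) x, |Torus.partialDeriv k (Torus.partialDeriv l φ) x| ≤ Lφ) →
    ∀ β : ℝ, |β| ≤ β₀ → ∀ ε : ℝ, 0 < ε → ∃ τ₀ : ℝ, 0 < τ₀ ∧ ∀ τ : ℝ, τ₀ ≤ τ →
    ∃ N₀ : ℕ, ∀ N : ℕ, N₀ ≤ N →
      (let ρ₀ : T3 → ℝ := rhoLim (profileOf a ha ha0) σ
       let w : ℝ := τ * ((N : ℝ) + 1) ^ (-(1 / 3 : ℝ))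
       let P := localGibbsLaw σ a u₀ θ₀ N (Φ N)
       let Z : T3 → ℝ := fun x => hsCompressibility (ρ₀ x * σ ^ 3)
       let Z' : T3 → ℝ := fun x => deriv hsCompressibility (ρ₀ x * σ ^ 3)
       let act := fun (i : Fin (N + 1)) z => σ / τ * (Φ N).collisionSum (Set.Ioc 0 w)
         (fun c => if c.fst = i then ‖c.postVel.1 - c.preVel.1‖ + |‖c.postVel.1‖ ^ 2 - ‖c.preVel.1‖ ^ 2| / 2
           else 0) z
       let ω := fun (i : Fin (N + 1)) z => if act i z ≤ V then (1 : ℝ) else 0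
       let Xm := fun (k : Fin 3) z => (Φ N).collisionSum (Set.Ioc 0 w)
         (fun c => ω c.fst z * ω c.snd z * ((φ c.fstPos - φ c.sndPos) * (c.postVel.1 k - c.preVel.1 k)) / 2) z
       let Am := fun (k : Fin 3) z => (∫ r in (0 : ℝ)..w, ∑ i : Fin (N + 1),
           Torus.partialDeriv k φ ((Φ N).flow r z i).1 *
             (θ₀ ((Φ N).flow r z i).1 * (ρ₀ ((Φ N).flow r z i).1 * σ ^ 3) * Z' ((Φ N).flow r z i).1 +
               (1 / 3) * (Z ((Φ N).flow r z i).1 - 1) * ‖((Φ N).flow r z i).2 - u₀ ((Φ N).flow r z i).1‖ ^ 2)) -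
         w * ((N : ℝ) + 1) * ∫ x, ρ₀ x * Torus.partialDeriv k φ x * (θ₀ x * (ρ₀ x * σ ^ 3) * Z' x)
       let Xe := fun z => (Φ N).collisionSum (Set.Ioc 0 w)
         (fun c => ω c.fst z * ω c.snd z *
           ((φ c.fstPos - φ c.sndPos) * ((‖c.postVel.1‖ ^ 2 - ‖c.preVel.1‖ ^ 2) / 2)) / 2) z
       let Ae := fun z => (∫ r in (0 : ℝ)..w, ∑ i : Fin (N + 1),
           ((∑ l : Fin 3, u₀ ((Φ N).flow r z i).1 l * Torus.partialDeriv l φ ((Φ N).flow r z i).1) *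
               (θ₀ ((Φ N).flow r z i).1 * (ρ₀ ((Φ N).flow r z i).1 * σ ^ 3) * Z' ((Φ N).flow r z i).1 +
                 (1 / 3) * (Z ((Φ N).flow r z i).1 - 1) * ‖((Φ N).flow r z i).2 - u₀ ((Φ N).flow r z i).1‖ ^ 2) +
             θ₀ ((Φ N).flow r z i).1 * (Z ((Φ N).flow r z i).1 - 1) *
               (∑ l : Fin 3, Torus.partialDeriv l φ ((Φ N).flow r z i).1 *
                 (((Φ N).flow r z i).2 - u₀ ((Φ N).flow r z i).1) l))) -
         w * ((N : ℝ) + 1) * ∫ x, ρ₀ x * (∑ l : Fin 3, u₀ x l * Torus.partialDeriv l φ x) *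
           (θ₀ x * (ρ₀ x * σ ^ 3) * Z' x)
       (∀ k : Fin 3, ∫⁻ z, ENNReal.ofReal (Real.exp (β * (w⁻¹ * Xm k z - w⁻¹ * Am k z))) ∂P ≤
           ENNReal.ofReal (Real.exp (ε * ((N : ℝ) + 1)))) ∧
         ∫⁻ z, ENNReal.ofReal (Real.exp (β * (w⁻¹ * Xe z - w⁻¹ * Ae z))) ∂P ≤
           ENNReal.ofReal (Real.exp (ε * ((N : ℝ) + 1))))

/-- The transfer card 1 hands to a crux-plan seat: the profile-wise node with numeric thresholds implies
the family crux (finite `ε`-net in `s` chosen after `(V, β, ε)`; Cauchy–Schwarz law swap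
`KineticCurrentsLDAlongFamiliesSketch.LawChange.lintegral_le_of_renyi_two` between neighbouring family
members; the pathwise test-function moduli above; the static family modulus of the EOS projection dominated
by conserved energy). [folklore] -/
def SharpImpliesCrux : Prop :=
  LocalClampedTransferLDSharp →
    Summit.AtomisticToContinuum.HydrodynamicLimit.Theses.OneFlightGossipEngine.LocalClampedTransferLDAlongFamilies

/-! ### Card 2 — the clamp deficit localises at first moment -/

/-- The crux's window TRANSFER activity of particle `i` (window `(0, τ(N+1)^{-1/3}]`). [folklore] -/
def transferAct (σ τ : ℝ) (N : ℕ)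
    (Φ : HardSphereFlow (Torus.geometry (Fin 3)) (hsDiameter σ N) (N + 1)) (i : Fin (N + 1))
    (z : Config (N + 1) (Fin 3) T3) : ℝ :=
  σ / τ * Φ.collisionSum (Set.Ioc 0 (τ * ((N : ℝ) + 1) ^ (-(1 / 3 : ℝ))))
    (fun c => if c.fst = i then ‖c.postVel.1 - c.preVel.1‖ + |‖c.postVel.1‖ ^ 2 - ‖c.preVel.1‖ ^ 2| / 2
      else 0) z

/-- **(H) HOMOGENEOUS DEFICIT DECAY, UNIFORM OVER A COMPACT PARAMETER BOX** — the F2 half of C′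
(TwoClocks 16623: tagged transfer-activity tail / clamp deficit `d(τ,V) → 0`) for CONSTANT profiles, with
thresholds uniform over `θ₀ ∈ [θm, θM]`, `‖u₀‖ ≤ U`, `σ ∈ [σm, σM]` (the σ-range carries the local PACKING
`ρ₀(x)σ³` through the blow-up dictionary `σ'' = σ ρ₀(x)^{1/3}`). Probability level, tagged particle `0`.
[folklore] -/
def HomDeficitDecayUniform : Prop :=
  ∀ (θm θM U σm σM : ℝ), 0 < θm → θm ≤ θM → 0 ≤ U → 0 < σm → σm ≤ σM → σM < 1 / 2 →
    ∃ V₀ : ℝ, 0 < V₀ ∧ ∀ V : ℝ, V₀ ≤ V → ∀ κ : ℝ, 0 < κ →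
    ∃ τ₀ : ℝ, 0 < τ₀ ∧ ∀ τ : ℝ, τ₀ ≤ τ → ∃ N₀ : ℕ, ∀ N : ℕ, N₀ ≤ N →
    ∀ (θ₀ : ℝ) (u₀ : V3) (σ : ℝ), θm ≤ θ₀ → θ₀ ≤ θM → ‖u₀‖ ≤ U → σm ≤ σ → σ ≤ σM →
    ∀ Φ : HardSphereFlow (Torus.geometry (Fin 3)) (hsDiameter σ N) (N + 1),
      localGibbsLaw σ (fun _ => 1) (fun _ => u₀) (fun _ => θ₀) N Φ {z | V < transferAct σ τ N Φ 0 z} ≤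
        ENNReal.ofReal κ

/-- **(L) LOCAL DEFICIT DECAY** — the clamp deficit under the LOCAL Gibbs law (profile-wise): the mean
fraction of over-budget particles vanishes as the window grows, `V ≥ V₀` after the profiles. This is the
first-order (mean) channel through which the clamp enters the local node (every linear static mismatch of
the node is ∝ this deficit). [folklore] -/
def LocalDeficitDecay : Prop :=
  ∃ η₀ : ℝ, 0 < η₀ ∧ ∀ (a θ₀ : T3 → ℝ) (u₀ : T3 → V3), Continuous a → Continuous θ₀ → Continuous u₀ →
    (∀ x, 0 < a x) → (∀ x, 0 < θ₀ x) → ∀ σ : ℝ, 0 < σ → σ < 1 / 2 →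
    σ ^ 3 * (⨆ x, a x) ≤ η₀ * ∫ x, a x →
    ∃ V₀ : ℝ, 0 < V₀ ∧ ∀ V : ℝ, V₀ ≤ V → ∀ κ : ℝ, 0 < κ →
    ∃ τ₀ : ℝ, 0 < τ₀ ∧ ∀ τ : ℝ, τ₀ ≤ τ → ∃ N₀ : ℕ, ∀ N : ℕ, N₀ ≤ N →
    ∀ Φ : HardSphereFlow (Torus.geometry (Fin 3)) (hsDiameter σ N) (N + 1),
      (∑ i : Fin (N + 1), localGibbsLaw σ a u₀ θ₀ N Φ {z | V < transferAct σ τ N Φ i z}) ≤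
        ENNReal.ofReal (κ * ((N : ℝ) + 1))

/-- **Card 2's rung**: the homogeneous, box-uniform deficit decay implies the local one — by own-path
determination of the activity, FIRST-MOMENT influence locality (13916 restatement (A), true and forecast
worlds), and total-variation merging of ball marginals of the local and the homogeneous Gibbs laws at the
frozen local parameters under the dictionary `(σ'', τ'', N'') = (σρ₀^{1/3}, τρ₀^{1/3}, ρ₀N)`. [folklore] -/
def DeficitLocalisation : Prop :=
  HomDeficitDecayUniform → LocalDeficitDecay

end Summit.AtomisticToContinuum.HydrodynamicLimit.Cruxes.LocalClampedTransferLDAlongFamilies.IdeatorOne
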